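import Literature.Computability.AlgebraicComplexity.DIP20MonomialCountDP
import HarnessLib

/-!
# A kernel-checkable packed dynamic programme for the monomial counts `c_ν(d,n)` in ANY number
# of letters (pre-masked mixed-radix layout)

Topic `Literature/Computability/AlgebraicComplexity`; evaluator/plumbing companion (D-0014, no new
facts; the `def`s are evaluator plumbing) of `DIP20MonomialCounts.lean` (`countVecMultisetsL`,
`weakCompsL`) and `DIP20MonomialCountDP.lean` (`digitAt`; the FOUR-letter packed programme
`dpTables`/`dpTablesM` of val-lit-p4 g3).

Dörfler–Ikenmeyer–Panova 2020 (arXiv:1901.04576), eq. (4.3) (arXiv p. 9):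
`c_ν(d,n) = #{b : |b| = d, Σ_i b_i α^i = ν}`, the number of multisets of `d` weak `N`-compositions
`α^i` of `n` with vector sum `ν`; with eq. (4.4) (tree: `DIP20_eq_4_4_holds`,
`plethysmCoeffOfPartition_eq_sum_sign_dipMonomialCount`) these evaluate plethysm coefficients
`a_λ(d[n])` for partitions `λ` with `N` rows. The tree's packed programmes are hard-wired to `N = 4`
(`flat3`, `boxIdx`); the enumerating evaluator `countVecMultisetsL` does not survive the kernel at
`N = 7`, `d = 12` (the Landsberg–Manivel–Ressayre type `(19,7,2,2,2,2,2) ⊢ 36` of `S¹²(S³ℂ⁹)`).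
This file supplies the general-`N` route.

## Method (what is proved)

Coordinates `1, …, ℓ` of a count vector (`ℓ = N - 1`; coordinate `0` is implicit, pinned by the
total degree `|ν| = n·e`, `countVecMultisetsL_eq_zero_of_sum_ne`) live in the box `w_k < D_k`
(`InBox D w`), linearised in mixed radix with radices EQUAL to the box dimensions
(`posL D w = Σ_k w_k · Π_{j>k} D_j`, most significant first; `posL`/`decodeL` are inverse
bijections box ↔ `[0, Π D_k)`). Layer `e` of the programme is ONE natural number whose base-`2^F`
digit at `posL D w` is `countVecMultisetsL L e ((n e - |w|) :: w)` (`LayerOK`). Prepending a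
composition `α = a₀ :: αt` to `L` is the geometric step (`countVecMultisetsL_cons_succ`)
`c(α::L, e+1, v) = c(L, e+1, v) + [α ≤ v] c(α::L, e, v - α)`, i.e. on packed layers
`new_{e+1} = old_{e+1} + ((new_e &&& mask_α) · 2^{F·posL D αt})` (`stepTail`), where `mask_α`
(`maskL F (shrink D αt) D`, all-ones digits exactly on the cells `w'` with `w' + αt` in the box)
is applied BEFORE the shift — so a shift never carries between axes and no padding is needed
(contrast `dpTablesM`). Correctness: `digitAt_tables` / `countVecMultisetsL_eq_digitAt_tables`
(digit = count for every box cell and every layer `e ≤ d`, given the digit bound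
`(|weakCompsL N n| + 2)^d ≤ 2^F`, `countVecMultisetsL_le_pow`). Ingredients: carry-free digit
arithmetic (`digitAt_add`, `digitAt_mul_pow`, `digitAt_land` — re-proved here, the four-letter
file keeps them private), the block-repeat lemma `digitAt_repBlock` behind the mask
(`digitAt_maskL`), the mixed-radix calculus (`posL_decodeL`, `decodeL_posL`, `posL_addVecL`,
`posL_lt_strideL`), and the list forms of the counting recursion, the total-degree pinning and the
size bound for `countVecMultisetsL`.

Kernel cost (farm, `decide +kernel`): `N = 7`, `n = 3`, `d = 12`, box `13·7·6·5·4·3 = 32 760`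
cells, `F = 49`: all `84` compositions in ≈ 5 s (one layer ≈ 1.6·10⁶ bits).

HONEST FRAMING: elementary counting/evaluation plumbing; nothing here bears on permanent versus
determinant; VP ≠ VNP is not proved and nothing in this file is progress on it.

## References

* [DorflerIkenmeyerPanova2020] J. Dörfler, C. Ikenmeyer, G. Panova, SIAM J. Appl. Algebra Geom. 4
  (2020) = arXiv:1901.04576, eq. (4.3)–(4.4) (arXiv p. 9).
* D. E. Knuth, *The Art of Computer Programming* 2, §4.3.3 / §4.6.4 (Kronecker substitution).
  [folklore]

## Tree

`digitAt`, `countVecMultisetsL`, `weakCompsL`, `sumUpTo`, `leVecL`, `subVecL`, `allZeroL`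
(`DIP20MonomialCounts`, `DIP20MonomialCountDP`).
-/

namespace Literature.Computability.AlgebraicComplexity

namespace BoxDP

/-! ### §1 Base-`2^F` digit arithmetic (re-proved; private upstream) -/

section Digits

/-- The digit at position `0`. [folklore] -/
private theorem digitAt_zero_right (F N : ℕ) : digitAt F N 0 = N % 2 ^ F := by
  simp [digitAt]

/-- Shifting the position by one divides by the base. [folklore] -/
private theorem digitAt_succ (F N i : ℕ) : digitAt F N (i + 1) = digitAt F (N / 2 ^ F) i := by
  unfold digitAt
  rw [Nat.mul_succ, pow_add, mul_comm (2 ^ (F * i)), ← Nat.div_div_eq_div_mul]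

/-- The digits of `0`. [folklore] -/
private theorem digitAt_zero (F i : ℕ) : digitAt F 0 i = 0 := by
  simp [digitAt]

/-- Digits are `< 2^F`. [folklore] -/
private theorem digitAt_lt (F N i : ℕ) : digitAt F N i < 2 ^ F :=
  Nat.mod_lt _ (Nat.two_pow_pos _)

/-- The digits of a one-digit number. [folklore] -/
private theorem digitAt_of_lt {F y : ℕ} (hy : y < 2 ^ F) (j : ℕ) :
    digitAt F y j = if j = 0 then y else 0 := by
  unfold digitAt
  split_ifs with hj
  · subst hj
    simp [Nat.mod_eq_of_lt hy]
  · have hle : 2 ^ F ≤ 2 ^ (F * j) :=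
      Nat.pow_le_pow_right (by norm_num) (Nat.le_mul_of_pos_right F (Nat.pos_of_ne_zero hj))
    rw [Nat.div_eq_of_lt (lt_of_lt_of_le hy hle), Nat.zero_mod]

/-- A number below `2^{FK}` has no digits at positions `≥ K`. [folklore] -/
private theorem digitAt_eq_zero_of_lt {F X K i : ℕ} (hX : X < 2 ^ (F * K)) (hi : K ≤ i) :
    digitAt F X i = 0 := by
  unfold digitAt
  have hle : 2 ^ (F * K) ≤ 2 ^ (F * i) := Nat.pow_le_pow_right (by norm_num) (Nat.mul_le_mul_left F hi)
  rw [Nat.div_eq_of_lt (lt_of_lt_of_le hX hle), Nat.zero_mod]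

/-- **Carry-free addition**: if no digit sum reaches the base, the digits of the sum are the sums
of the digits. [folklore] -/
private theorem digitAt_add {F : ℕ} :
    ∀ (A C : ℕ), (∀ j, digitAt F A j + digitAt F C j < 2 ^ F) →
      ∀ i, digitAt F (A + C) i = digitAt F A i + digitAt F C i := by
  intro A C h i
  induction i generalizing A C with
  | zero =>
    have h0 := h 0
    rw [digitAt_zero_right, digitAt_zero_right] at h0
    rw [digitAt_zero_right, digitAt_zero_right, digitAt_zero_right, Nat.add_mod, Nat.mod_eq_of_lt h0]
  | succ i ih =>
    have h0 := h 0
    rw [digitAt_zero_right, digitAt_zero_right] at h0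
    rw [digitAt_succ, digitAt_succ, digitAt_succ, Nat.add_div_eq_of_add_mod_lt h0]
    exact ih _ _ fun j => by rw [← digitAt_succ, ← digitAt_succ]; exact h (j + 1)

/-- **Shift**: multiplying by `2^{Fs}` moves the digits up by `s` positions. [folklore] -/
private theorem digitAt_mul_pow (F B s i : ℕ) :
    digitAt F (B * 2 ^ (F * s)) i = if s ≤ i then digitAt F B (i - s) else 0 := by
  unfold digitAt
  have hpos : ∀ t : ℕ, 0 < 2 ^ t := fun t => Nat.two_pow_pos _
  split_ifs with h
  · obtain ⟨k, rfl⟩ := Nat.exists_eq_add_of_le h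
    rw [Nat.add_sub_cancel_left, Nat.mul_add, pow_add, mul_comm B,
      Nat.mul_div_mul_left _ _ (hpos _)]
  · obtain ⟨k, rfl⟩ := Nat.exists_eq_add_of_lt (not_le.mp h)
    have hs : F * (i + k + 1) = F * i + F * (k + 1) := by ring
    rw [hs, pow_add, mul_comm (2 ^ (F * i)), ← mul_assoc, Nat.mul_div_cancel _ (hpos _)]
    apply Nat.mod_eq_zero_of_dvd
    exact Dvd.dvd.mul_left (pow_dvd_pow 2 (Nat.le_mul_of_pos_right F (Nat.succ_pos k))) B

/-- The bits of a digit. [folklore] -/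
private theorem testBit_digitAt (F N p i : ℕ) :
    (digitAt F N p).testBit i = (decide (i < F) && N.testBit (F * p + i)) := by
  unfold digitAt
  rw [Nat.testBit_mod_two_pow, Nat.testBit_div_two_pow, Nat.add_comm]

/-- **Digits of a bitwise `and`** are the `and`s of the digits. [folklore] -/
private theorem digitAt_land (F x y p : ℕ) :
    digitAt F (x &&& y) p = digitAt F x p &&& digitAt F y p := by
  apply Nat.eq_of_testBit_eq
  intro i
  rw [Nat.testBit_land, testBit_digitAt, testBit_digitAt, testBit_digitAt, Nat.testBit_land]
  cases decide (i < F) <;> simp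

/-- `and` with the all-ones digit is the identity on digits. [folklore] -/
private theorem land_ones_of_lt {F y : ℕ} (hy : y < 2 ^ F) : y &&& (2 ^ F - 1) = y := by
  rw [Nat.and_two_pow_sub_one_eq_mod, Nat.mod_eq_of_lt hy]

/-- A number all of whose digits vanish from position `K` on is `< 2^{FK}`. [folklore] -/
private theorem lt_pow_of_digitAt_eq_zero {F : ℕ} (hF : 0 < F) :
    ∀ (K X : ℕ), (∀ i, K ≤ i → digitAt F X i = 0) → X < 2 ^ (F * K) := by
  intro K
  induction K with
  | zero =>
    intro X h
    -- all digits vanish: X = 0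
    have hzero : ∀ Y : ℕ, (∀ i, digitAt F Y i = 0) → Y = 0 := by
      intro Y
      induction Y using Nat.strong_induction_on with
      | _ Y ih =>
        intro hY
        by_cases hY0 : Y = 0
        · exact hY0
        · exfalso
          have h0 := hY 0
          rw [digitAt_zero_right] at h0
          have hlt : Y / 2 ^ F < Y := Nat.div_lt_self (Nat.pos_of_ne_zero hY0) (Nat.one_lt_two_pow hF.ne')
          have hq : Y / 2 ^ F = 0 := ih _ hlt fun i => by rw [← digitAt_succ]; exact hY (i + 1)
          have := Nat.div_add_mod Y (2 ^ F)
          rw [hq, h0] at this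
          omega
    have := hzero X fun i => h i (Nat.zero_le i)
    subst this
    simp
  | succ K ih =>
    intro X h
    have hq : X / 2 ^ F < 2 ^ (F * K) := ih _ fun i hi => by rw [← digitAt_succ]; exact h (i + 1) (by omega)
    have := Nat.div_add_mod X (2 ^ F)
    have hmod : X % 2 ^ F < 2 ^ F := Nat.mod_lt _ (Nat.two_pow_pos _)
    rw [Nat.mul_succ, pow_add]
    calc X = 2 ^ F * (X / 2 ^ F) + X % 2 ^ F := this.symm
      _ < 2 ^ F * (X / 2 ^ F) + 2 ^ F := by omega
      _ = 2 ^ F * (X / 2 ^ F + 1) := by ring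
      _ ≤ 2 ^ F * 2 ^ (F * K) := Nat.mul_le_mul_left _ hq
      _ = 2 ^ (F * K) * 2 ^ F := by ring

end Digits

/-! ### §2 List vectors, boxes and the mixed-radix position -/

section Vectors

/-- `w` lies in the box with dimensions `D` (same length and `w_k < D_k`): the index set of the
packed table of the counts `c_ν(d,n)` of eq. (4.3), coordinates `1, …, |D|` of `ν`.
[cite: DorflerIkenmeyerPanova2020, eq. (4.3) (arXiv p. 9)] -/
def InBox : List ℕ → List ℕ → Prop
  | [], [] => True
  | d :: ds, w :: ws => w < d ∧ InBox ds ws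
  | _, _ => False

/-- Componentwise `D' ≤ D` (same length). [folklore] -/
private def LeVec : List ℕ → List ℕ → Prop
  | [], [] => True
  | a :: as, b :: bs => a ≤ b ∧ LeVec as bs
  | _, _ => False

/-- The number of cells of the box (product of the dimensions). [folklore] -/
def strideL : List ℕ → ℕ
  | [] => 1
  | d :: ds => d * strideL ds

/-- The mixed-radix position of a cell, radices = the box dimensions, most significant first.
[folklore] -/
def posL : List ℕ → List ℕ → ℕ
  | _ :: ds, w :: ws => w * strideL ds + posL ds ws
  | _, _ => 0

/-- The mixed-radix digits of a position. [folklore] -/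
def decodeL : List ℕ → ℕ → List ℕ
  | [], _ => []
  | _ :: ds, p => (p / strideL ds) :: decodeL ds (p % strideL ds)

/-- Componentwise sum of two vectors (truncating to the shorter). [folklore] -/
def addVecL : List ℕ → List ℕ → List ℕ
  | a :: as, b :: bs => (a + b) :: addVecL as bs
  | _, _ => []

/-- The box shrunk by `α`: dimensions `D_k - α_k`. [folklore] -/
def shrink : List ℕ → List ℕ → List ℕ
  | d :: ds, a :: as => (d - a) :: shrink ds as
  | _, _ => []

/-- Plumbing lemma `inBox_nil_iff` (list/table bookkeeping). [folklore] -/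
private theorem inBox_nil_iff (w : List ℕ) : InBox [] w ↔ w = [] := by
  cases w <;> simp [InBox]

/-- Plumbing lemma `inBox_cons_iff` (list/table bookkeeping). [folklore] -/
private theorem inBox_cons_iff (d : ℕ) (ds w : List ℕ) :
    InBox (d :: ds) w ↔ ∃ v vs, w = v :: vs ∧ v < d ∧ InBox ds vs := by
  cases w with
  | nil => simp [InBox]
  | cons v vs => simp [InBox]

/-- A box cell has the length of the dimension vector. [folklore] -/
private theorem InBox.length_eq : ∀ {D w : List ℕ}, InBox D w → w.length = D.length
  | [], [], _ => rfl
  | [], _ :: _, h => by simp [InBox] at h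
  | _ :: _, [], h => by simp [InBox] at h
  | _ :: ds, _ :: ws, h => by
    simp only [List.length_cons, Nat.add_right_cancel_iff]
    exact InBox.length_eq (D := ds) h.2

/-- A nonempty box has positive volume. [folklore] -/
private theorem strideL_pos_of_inBox : ∀ {D w : List ℕ}, InBox D w → 0 < strideL D
  | [], [], _ => Nat.one_pos
  | [], _ :: _, h => by simp [InBox] at h
  | _ :: _, [], h => by simp [InBox] at h
  | d :: ds, v :: vs, h => by
    simp only [InBox] at h
    simp only [strideL]
    exact Nat.mul_pos (by omega) (strideL_pos_of_inBox h.2)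

/-- Positions of box cells are below the volume. [folklore] -/
private theorem posL_lt_strideL : ∀ {D w : List ℕ}, InBox D w → posL D w < strideL D
  | [], [], _ => by simp [posL, strideL]
  | [], _ :: _, h => by simp [InBox] at h
  | _ :: _, [], h => by simp [InBox] at h
  | d :: ds, v :: vs, h => by
    simp only [InBox] at h
    simp only [posL, strideL]
    have ih := posL_lt_strideL h.2
    have hS : 0 < strideL ds := strideL_pos_of_inBox h.2
    calc v * strideL ds + posL ds vs < v * strideL ds + strideL ds := by omega
      _ = (v + 1) * strideL ds := by ring
      _ ≤ d * strideL ds := Nat.mul_le_mul_right _ h.1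

/-- Decoding inverts the position map on all positions. [folklore] -/
private theorem posL_decodeL : ∀ (D : List ℕ) (p : ℕ), p < strideL D → posL D (decodeL D p) = p
  | [], p, hp => by simp [strideL] at hp; simp [posL, hp]
  | d :: ds, p, hp => by
    simp only [decodeL, posL]
    rw [posL_decodeL ds (p % strideL ds) (Nat.mod_lt _ ?_)]
    · rw [mul_comm]; exact Nat.div_add_mod p (strideL ds)
    · simp only [strideL] at hp
      rcases Nat.eq_zero_or_pos (strideL ds) with h0 | h0
      · rw [h0, Nat.mul_zero] at hp; omega
      · exact h0

/-- Every position below the volume decodes to a box cell. [folklore] -/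
private theorem inBox_decodeL : ∀ (D : List ℕ) (p : ℕ), p < strideL D → InBox D (decodeL D p)
  | [], p, _ => by simp [decodeL, InBox]
  | d :: ds, p, hp => by
    simp only [decodeL, InBox]
    simp only [strideL] at hp
    have hS : 0 < strideL ds := by
      rcases Nat.eq_zero_or_pos (strideL ds) with h0 | h0
      · rw [h0, Nat.mul_zero] at hp; omega
      · exact h0
    refine ⟨?_, inBox_decodeL ds _ (Nat.mod_lt _ hS)⟩
    rw [Nat.div_lt_iff_lt_mul hS]
    exact hp

/-- The position map is injective on the box: decoding a position recovers the cell. [folklore] -/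
private theorem decodeL_posL : ∀ {D w : List ℕ}, InBox D w → decodeL D (posL D w) = w
  | [], [], _ => by simp [decodeL]
  | [], _ :: _, h => by simp [InBox] at h
  | _ :: _, [], h => by simp [InBox] at h
  | d :: ds, v :: vs, h => by
    simp only [InBox] at h
    simp only [posL, decodeL]
    have hS : 0 < strideL ds := strideL_pos_of_inBox h.2
    have hlt : posL ds vs < strideL ds := posL_lt_strideL h.2
    have hdiv : (v * strideL ds + posL ds vs) / strideL ds = v := by
      rw [mul_comm, Nat.mul_add_div hS, Nat.div_eq_of_lt hlt, Nat.add_zero]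
    have hmod : (v * strideL ds + posL ds vs) % strideL ds = posL ds vs := by
      rw [mul_comm, Nat.mul_add_mod, Nat.mod_eq_of_lt hlt]
    rw [hdiv, hmod, decodeL_posL h.2]

/-- Linearity of the position map in the cell (same lengths). [folklore] -/
private theorem posL_addVecL : ∀ (D w a : List ℕ), w.length = D.length → a.length = D.length →
    posL D (addVecL w a) = posL D w + posL D a
  | [], [], [], _, _ => by simp [posL]
  | d :: ds, v :: vs, b :: bs, hw, ha => by
    simp only [addVecL, posL]
    simp only [List.length_cons, Nat.add_right_cancel_iff] at hw ha
    rw [posL_addVecL ds vs bs hw ha]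
    ring
  | [], _ :: _, _, h, _ => by simp at h
  | [], [], _ :: _, _, h => by simp at h
  | _ :: _, [], _, h, _ => by simp at h
  | _ :: _, _ :: _, [], _, h => by simp at h

/-- A cell of the shrunk box, translated by `α`, is a cell of the box. [folklore] -/
private theorem inBox_addVecL_of_inBox_shrink : ∀ {D a w : List ℕ}, a.length = D.length →
    InBox (shrink D a) w → InBox D (addVecL w a)
  | [], [], w, _, h => by
    simp only [shrink] at h
    rw [inBox_nil_iff] at h; subst h; simp [addVecL, InBox]
  | d :: ds, b :: bs, w, ha, h => by
    simp only [shrink] at h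
    obtain ⟨v, vs, rfl, hv, hvs⟩ := (inBox_cons_iff _ _ _).mp h
    simp only [addVecL, InBox]
    simp only [List.length_cons, Nat.add_right_cancel_iff] at ha
    exact ⟨by omega, inBox_addVecL_of_inBox_shrink ha hvs⟩
  | [], _ :: _, _, h, _ => by simp at h
  | _ :: _, [], _, h, _ => by simp at h

/-- Cells of the shrunk box have the length of `D`. [folklore] -/
private theorem length_eq_of_inBox_shrink : ∀ {D a w : List ℕ}, a.length = D.length →
    InBox (shrink D a) w → w.length = D.length
  | [], [], w, _, h => by
    simp only [shrink] at h
    rw [inBox_nil_iff] at h; subst h; rfl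
  | d :: ds, b :: bs, w, ha, h => by
    simp only [shrink] at h
    obtain ⟨v, vs, rfl, hv, hvs⟩ := (inBox_cons_iff _ _ _).mp h
    simp only [List.length_cons, Nat.add_right_cancel_iff] at ha ⊢
    exact length_eq_of_inBox_shrink ha hvs
  | [], _ :: _, _, h, _ => by simp at h
  | _ :: _, [], _, h, _ => by simp at h

/-- `leVecL 1 a w` (the tree's componentwise test `a ≤ w`) and the translate `w - a`:
if `a ≤ w` then `(w - a) + a = w`. [folklore] -/
private theorem addVecL_subVecL_of_leVecL : ∀ {a w : List ℕ}, a.length = w.length →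
    leVecL 1 a w = true → addVecL (subVecL 1 a w) a = w
  | [], [], _, _ => by simp [subVecL, addVecL]
  | b :: bs, v :: vs, hl, h => by
    simp only [leVecL, Bool.and_eq_true, decide_eq_true_eq, Nat.one_mul] at h
    simp only [subVecL, addVecL, Nat.one_mul]
    simp only [List.length_cons, Nat.add_right_cancel_iff] at hl
    rw [addVecL_subVecL_of_leVecL hl h.2]
    congr 1
    omega
  | [], _ :: _, h, _ => by simp at h
  | _ :: _, [], h, _ => by simp at h

/-- If `a ≤ w` and `w` is in the box then `w - a` is in the box shrunk by `a`. [folklore] -/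
private theorem inBox_shrink_subVecL : ∀ {D a w : List ℕ}, a.length = D.length → InBox D w →
    leVecL 1 a w = true → InBox (shrink D a) (subVecL 1 a w)
  | [], [], [], _, _, _ => by simp [shrink, subVecL, InBox]
  | d :: ds, b :: bs, v :: vs, hl, hw, h => by
    simp only [leVecL, Bool.and_eq_true, decide_eq_true_eq, Nat.one_mul] at h
    simp only [InBox] at hw
    simp only [shrink, subVecL, InBox, Nat.one_mul]
    simp only [List.length_cons, Nat.add_right_cancel_iff] at hl
    exact ⟨by omega, inBox_shrink_subVecL hl hw.2 h.2⟩
  | [], _ :: _, _, h, _, _ => by simp at h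
  | _ :: _, [], _, h, _, _ => by simp at h
  | [], [], _ :: _, _, h, _ => by simp [InBox] at h
  | _ :: _, _ :: _, [], _, h, _ => by simp [InBox] at h

/-- If `w' + a = w` (same lengths) then `a ≤ w` and `w - a = w'`. [folklore] -/
private theorem leVecL_subVecL_of_addVecL_eq : ∀ {a w' : List ℕ}, a.length = w'.length →
    leVecL 1 a (addVecL w' a) = true ∧ subVecL 1 a (addVecL w' a) = w'
  | [], [], _ => by simp [leVecL, subVecL, addVecL]
  | b :: bs, v :: vs, hl => by
    simp only [List.length_cons, Nat.add_right_cancel_iff] at hl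
    obtain ⟨h1, h2⟩ := leVecL_subVecL_of_addVecL_eq hl
    refine ⟨?_, ?_⟩
    · simp only [addVecL, leVecL, Nat.one_mul, Bool.and_eq_true, decide_eq_true_eq]
      exact ⟨by omega, h1⟩
    · simp only [addVecL, subVecL, Nat.one_mul]
      rw [h2]
      congr 1
      omega
  | [], _ :: _, h => by simp at h
  | _ :: _, [], h => by simp at h

/-- The sum of a translate: `|w - a| = |w| - |a|` when `a ≤ w`. [folklore] -/
private theorem sum_subVecL_of_leVecL : ∀ {a w : List ℕ}, a.length = w.length → leVecL 1 a w = true →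
    (subVecL 1 a w).sum + a.sum = w.sum
  | [], [], _, _ => by simp [subVecL]
  | b :: bs, v :: vs, hl, h => by
    simp only [leVecL, Bool.and_eq_true, decide_eq_true_eq, Nat.one_mul] at h
    simp only [List.length_cons, Nat.add_right_cancel_iff] at hl
    simp only [subVecL, Nat.one_mul, List.sum_cons]
    have := sum_subVecL_of_leVecL hl h.2
    omega
  | [], _ :: _, h, _ => by simp at h
  | _ :: _, [], h, _ => by simp at h

end Vectors

/-! ### §3 The block-repeat lemma and the box masks -/

section Mask

/-- `Σ_{q<m} M · 2^{F s q}`: the number `M` (occupying `s` digits) repeated `m` times. [folklore] -/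
def repBlock (F s M : ℕ) : ℕ → ℕ
  | 0 => 0
  | m + 1 => repBlock F s M m + M * 2 ^ (F * s * m)

/-- The all-ones-digit mask of the sub-box `w_k < D'_k` inside the layout with radices `D`:
digit `2^F - 1` at the positions `posL D w` of the cells `w` of `D` with `w < D'`, else `0`.
[folklore] -/
def maskL (F : ℕ) : List ℕ → List ℕ → ℕ
  | d' :: ds', _ :: ds => repBlock F (strideL ds) (maskL F ds' ds) d'
  | _, _ => 2 ^ F - 1

/-- Size of a repeated block. [folklore] -/
private theorem repBlock_lt {F s M : ℕ} (hM : M < 2 ^ (F * s)) :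
    ∀ m, repBlock F s M m < 2 ^ (F * s * m) ⊔ 1
  | 0 => by simp [repBlock]
  | m + 1 => by
    rw [repBlock]
    have ih := repBlock_lt hM m
    have h1 : repBlock F s M m < 2 ^ (F * s * m) := by
      rcases Nat.eq_zero_or_pos (F * s * m) with h0 | h0
      · -- then `2^0 = 1` and `M < 2^{Fs}`; if `F s m = 0` with … handle via ih
        rw [h0, pow_zero] at ih ⊢
        simpa using ih
      · have : 1 ≤ 2 ^ (F * s * m) := Nat.one_le_two_pow
        rw [sup_eq_left.mpr this] at ih
        exact ih
    apply lt_sup_of_lt_left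
    have hM' : M + 1 ≤ 2 ^ (F * s) := hM
    calc repBlock F s M m + M * 2 ^ (F * s * m)
        < 2 ^ (F * s * m) + M * 2 ^ (F * s * m) := by omega
      _ = (M + 1) * 2 ^ (F * s * m) := by ring
      _ ≤ 2 ^ (F * s) * 2 ^ (F * s * m) := Nat.mul_le_mul_right _ hM'
      _ = 2 ^ (F * s * (m + 1)) := by rw [← pow_add]; ring_nf

/-- **Digits of a repeated block**: position `p` reads the block digit `p mod s` if the block
index `p / s` is `< m`, and `0` beyond. [folklore] -/
private theorem digitAt_repBlock {F s M : ℕ} (hs : 0 < s) (hM : M < 2 ^ (F * s)) :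
    ∀ (m p : ℕ), digitAt F (repBlock F s M m) p = if p / s < m then digitAt F M (p % s) else 0
  | 0, p => by simp [repBlock, digitAt_zero]
  | m + 1, p => by
    rw [repBlock]
    have hA : ∀ q, digitAt F (repBlock F s M m) q = if q / s < m then digitAt F M (q % s) else 0 :=
      digitAt_repBlock hs hM m
    have hC : ∀ q, digitAt F (M * 2 ^ (F * s * m)) q =
        if q / s = m then digitAt F M (q % s) else 0 := by
      intro q
      rw [show F * s * m = F * (s * m) by ring, digitAt_mul_pow]
      by_cases hq : s * m ≤ q
      · rw [if_pos hq]
        by_cases hqm : q / s = m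
        · rw [if_pos hqm]
          congr 1
          -- `q - s m = q % s` when `q / s = m`
          have := Nat.div_add_mod q s
          rw [hqm] at this
          omega
        · rw [if_neg hqm]
          -- then `q / s > m`, so `q - s m ≥ s`: digit of `M` beyond position `s` vanishes
          have hgt : m < q / s := by
            rcases Nat.lt_or_gt_of_ne hqm with h | h
            · exfalso
              have : q < s * m := by
                have := Nat.div_add_mod q s
                have hms : q / s + 1 ≤ m := h
                have := Nat.mod_lt q hs
                nlinarith
              omega
            · exact h
          apply digitAt_eq_zero_of_lt hM
          -- `s ≤ q - s m`
          have : s * (m + 1) ≤ q := by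
            have h1 : m + 1 ≤ q / s := hgt
            have := (Nat.le_div_iff_mul_le hs).mp h1
            linarith [this]
          have : s * m + s ≤ q := by linarith
          omega
      · rw [if_neg hq]
        have : q / s < m := by
          rw [Nat.div_lt_iff_lt_mul hs]; rw [mul_comm]; omega
        rw [if_neg (Nat.ne_of_lt this)]
    have nocarry : ∀ q, digitAt F (repBlock F s M m) q + digitAt F (M * 2 ^ (F * s * m)) q < 2 ^ F := by
      intro q
      rw [hA, hC]
      have := digitAt_lt F M (q % s)
      split_ifs <;> omega
    rw [digitAt_add _ _ nocarry, hA, hC]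
    rcases Nat.lt_trichotomy (p / s) m with h | h | h
    · rw [if_pos h, if_neg (Nat.ne_of_lt h), if_pos (Nat.lt_succ_of_lt h), Nat.add_zero]
    · rw [if_neg (by omega), if_pos h, if_pos (by omega), Nat.zero_add]
    · rw [if_neg (by omega), if_neg (by omega), if_neg (by omega)]

/-- Size of the mask: below `2^{F · volume}` provided `D' ≤ D`. [folklore] -/
private theorem maskL_lt {F : ℕ} (hF : 0 < F) : ∀ {D' D : List ℕ}, LeVec D' D →
    maskL F D' D < 2 ^ (F * strideL D)
  | [], [], _ => by
    simp only [maskL, strideL, Nat.mul_one]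
    exact Nat.sub_lt (Nat.two_pow_pos F) Nat.one_pos
  | d' :: ds', d :: ds, h => by
    simp only [LeVec] at h
    simp only [maskL, strideL]
    have ih := maskL_lt hF h.2
    have := repBlock_lt ih d'
    rcases Nat.eq_zero_or_pos (F * strideL ds * d') with h0 | h0
    · rw [h0, pow_zero] at this
      have hr : repBlock F (strideL ds) (maskL F ds' ds) d' = 0 := by simpa using this
      rw [hr]
      exact Nat.two_pow_pos _
    · rw [sup_eq_left.mpr (Nat.one_le_two_pow)] at this
      calc repBlock F (strideL ds) (maskL F ds' ds) d' < 2 ^ (F * strideL ds * d') := this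
        _ ≤ 2 ^ (F * (d * strideL ds)) := Nat.pow_le_pow_right (by norm_num) (by
            rw [mul_comm d, ← mul_assoc]; exact Nat.mul_le_mul_left _ h.1)
  | [], _ :: _, h => by simp [LeVec] at h
  | _ :: _, [], h => by simp [LeVec] at h

open Classical in
/-- **Digits of the mask**: at the position of a cell `w` of `D`, the mask of the sub-box `D' ≤ D`
reads `2^F - 1` if `w < D'` and `0` otherwise. [folklore] -/
private theorem digitAt_maskL_posL {F : ℕ} (hF : 0 < F) : ∀ {D' D w : List ℕ}, LeVec D' D → InBox D w →
    digitAt F (maskL F D' D) (posL D w) = if InBox D' w then 2 ^ F - 1 else 0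
  | [], [], [], _, _ => by
    simp only [maskL, posL, InBox, if_true]
    rw [digitAt_of_lt (Nat.sub_lt (Nat.two_pow_pos F) Nat.one_pos), if_pos rfl]
  | d' :: ds', d :: ds, v :: vs, hle, hw => by
    simp only [LeVec] at hle
    simp only [InBox] at hw
    simp only [maskL, posL, InBox]
    have hS : 0 < strideL ds := strideL_pos_of_inBox hw.2
    have hlt : posL ds vs < strideL ds := posL_lt_strideL hw.2
    have hM : maskL F ds' ds < 2 ^ (F * strideL ds) := maskL_lt hF hle.2
    rw [digitAt_repBlock hS hM]
    have hdiv : (v * strideL ds + posL ds vs) / strideL ds = v := by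
      rw [mul_comm, Nat.mul_add_div hS, Nat.div_eq_of_lt hlt, Nat.add_zero]
    have hmod : (v * strideL ds + posL ds vs) % strideL ds = posL ds vs := by
      rw [mul_comm, Nat.mul_add_mod, Nat.mod_eq_of_lt hlt]
    rw [hdiv, hmod, digitAt_maskL_posL hF hle.2 hw.2]
    by_cases hv : v < d'
    · rw [if_pos hv]
      by_cases hvs : InBox ds' vs
      · rw [if_pos hvs, if_pos ⟨hv, hvs⟩]
      · rw [if_neg hvs, if_neg (fun h => hvs h.2)]
    · rw [if_neg hv, if_neg (fun h => hv h.1)]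
  | [], _ :: _, _, h, _ => by simp [LeVec] at h
  | _ :: _, [], _, h, _ => by simp [LeVec] at h
  | [], [], _ :: _, _, h => by simp [InBox] at h
  | _ :: _, _ :: _, [], _, h => by simp [InBox] at h

/-- The shrunk box is contained in the box. [folklore] -/
private theorem leVec_shrink : ∀ (D a : List ℕ), a.length = D.length → LeVec (shrink D a) D
  | [], [], _ => by simp [shrink, LeVec]
  | d :: ds, b :: bs, h => by
    simp only [shrink, LeVec]
    simp only [List.length_cons, Nat.add_right_cancel_iff] at h
    exact ⟨Nat.sub_le _ _, leVec_shrink ds bs h⟩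
  | [], _ :: _, h => by simp at h
  | _ :: _, [], h => by simp at h

/-- A cell of a sub-box is a cell of the box. [folklore] -/
private theorem inBox_of_leVec : ∀ {D' D w : List ℕ}, LeVec D' D → InBox D' w → InBox D w
  | [], [], [], _, _ => trivial
  | d' :: ds', d :: ds, v :: vs, hle, hw => by
    simp only [LeVec] at hle
    simp only [InBox] at hw ⊢
    exact ⟨lt_of_lt_of_le hw.1 hle.1, inBox_of_leVec hle.2 hw.2⟩
  | [], _ :: _, _, h, _ => by simp [LeVec] at h
  | _ :: _, [], _, h, _ => by simp [LeVec] at h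
  | [], [], _ :: _, _, h => by simp [InBox] at h
  | _ :: _, _ :: _, [], _, h => by simp [InBox] at h

end Mask

/-! ### §4 The list form of the counting recursion, total-degree pinning, size bound -/

section Counting

/-- `sumUpTo f (d+1)` peeled at the bottom. [folklore] -/
private theorem sumUpTo_succ_left (f : ℕ → ℕ) (d : ℕ) :
    sumUpTo f (d + 1) = f 0 + sumUpTo (fun k => f (k + 1)) d := by
  induction d with
  | zero => simp [sumUpTo]
  | succ d ih => rw [sumUpTo, ih, sumUpTo]; ring

/-- `sumUpTo` only depends on the values `≤ d`. [folklore] -/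
private theorem sumUpTo_congr {f g : ℕ → ℕ} {d : ℕ} (h : ∀ k ≤ d, f k = g k) :
    sumUpTo f d = sumUpTo g d := by
  induction d with
  | zero => simp [sumUpTo, h 0 le_rfl]
  | succ d ih => rw [sumUpTo, sumUpTo, ih fun k hk => h k (by omega), h (d + 1) le_rfl]

/-- A sum of zeros. [folklore] -/
private theorem sumUpTo_eq_zero {f : ℕ → ℕ} {d : ℕ} (h : ∀ k ≤ d, f k = 0) : sumUpTo f d = 0 := by
  induction d with
  | zero => simpa [sumUpTo] using h 0 le_rfl
  | succ d ih => rw [sumUpTo, ih fun k hk => h k (by omega), h (d + 1) le_rfl]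

/-- Termwise bound for `sumUpTo`. [folklore] -/
private theorem sumUpTo_le_sumUpTo {f g : ℕ → ℕ} {d : ℕ} (h : ∀ k ≤ d, f k ≤ g k) :
    sumUpTo f d ≤ sumUpTo g d := by
  induction d with
  | zero => simpa [sumUpTo] using h 0 le_rfl
  | succ d ih => rw [sumUpTo, sumUpTo]; exact Nat.add_le_add (ih fun k hk => h k (by omega)) (h _ le_rfl)

/-- `leVecL 0` always holds and `subVecL 0` is the identity. [folklore] -/
private theorem leVecL_zero : ∀ (a w : List ℕ), leVecL 0 a w = true
  | [], [] => rfl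
  | [], _ :: _ => rfl
  | _ :: _, [] => rfl
  | _ :: as, _ :: ws => by simp [leVecL, leVecL_zero as ws]

/-- Plumbing lemma `subVecL_zero` (list/table bookkeeping). [folklore] -/
private theorem subVecL_zero : ∀ (a w : List ℕ), subVecL 0 a w = w
  | [], [] => rfl
  | [], _ :: _ => rfl
  | _ :: _, [] => rfl
  | _ :: as, v :: ws => by simp [subVecL, subVecL_zero as ws]

/-- `(k+1) a ≤ w` iff `a ≤ w` and `k a ≤ w - a`. [folklore] -/
private theorem leVecL_succ : ∀ (k : ℕ) (a w : List ℕ),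
    leVecL (k + 1) a w = (leVecL 1 a w && leVecL k a (subVecL 1 a w))
  | k, [], w => by cases w <;> simp [leVecL]
  | k, _ :: as, [] => by simp [leVecL, subVecL]
  | k, b :: as, v :: ws => by
    simp only [leVecL, subVecL, Nat.one_mul, leVecL_succ k as ws]
    by_cases h1 : b ≤ v
    · by_cases h2 : k * b ≤ v - b
      · have : (k + 1) * b ≤ v := by rw [Nat.add_mul, Nat.one_mul]; omega
        simp [h1, h2, this]
      · have : ¬ (k + 1) * b ≤ v := by rw [Nat.add_mul, Nat.one_mul]; omega
        simp [h1, h2, this]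
    · have : ¬ (k + 1) * b ≤ v := by
        rw [Nat.add_mul, Nat.one_mul]; intro h; exact h1 (le_trans (Nat.le_add_left _ _) h)
      simp [h1, this]

/-- `w - (k+1) a = (w - a) - k a`. [folklore] -/
private theorem subVecL_succ : ∀ (k : ℕ) (a w : List ℕ),
    subVecL (k + 1) a w = subVecL k a (subVecL 1 a w)
  | k, [], w => by cases w <;> simp [subVecL]
  | k, _ :: as, [] => by simp [subVecL]
  | k, b :: as, v :: ws => by
    simp only [subVecL, Nat.one_mul, subVecL_succ k as ws, Nat.add_mul, Nat.sub_sub]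
    rw [Nat.add_comm]

/-- Layer `0` is unchanged by prepending a composition. [folklore] -/
private theorem countVecMultisetsL_cons_zero (α : List ℕ) (L : List (List ℕ)) (ν : List ℕ) :
    countVecMultisetsL (α :: L) 0 ν = countVecMultisetsL L 0 ν := by
  rw [countVecMultisetsL, sumUpTo, leVecL_zero, if_pos rfl, subVecL_zero]

/-- **The geometric step** (list form of `countVecMultisets_cons_succ`):
`c(α::L, e+1, ν) = c(L, e+1, ν) + [α ≤ ν] · c(α::L, e, ν - α)`. [cite: DorflerIkenmeyerPanova2020, eq. (4.3) (arXiv p. 9)] -/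
theorem countVecMultisetsL_cons_succ (α : List ℕ) (L : List (List ℕ)) (e : ℕ) (ν : List ℕ) :
    countVecMultisetsL (α :: L) (e + 1) ν = countVecMultisetsL L (e + 1) ν +
      (if leVecL 1 α ν = true then countVecMultisetsL (α :: L) e (subVecL 1 α ν) else 0) := by
  rw [countVecMultisetsL, sumUpTo_succ_left, leVecL_zero, if_pos rfl, subVecL_zero, Nat.sub_zero]
  congr 1
  rw [countVecMultisetsL]
  by_cases h1 : leVecL 1 α ν = true
  · rw [if_pos h1]
    apply sumUpTo_congr
    intro k hk
    rw [leVecL_succ k α ν, h1, Bool.true_and, subVecL_succ k α ν, Nat.succ_sub_succ]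
  · rw [if_neg h1]
    apply sumUpTo_eq_zero
    intro k hk
    rw [leVecL_succ k α ν]
    simp [h1]

/-- All members of `weakCompsL N n` (the weak `N`-compositions of `n`, i.e. the exponent vectors
`α^i` of eq. (4.3)) have length `N` and sum `n`. [cite: DorflerIkenmeyerPanova2020, eq. (4.3) (arXiv p. 9)] -/
theorem length_sum_of_mem_weakCompsL : ∀ (N n : ℕ) (α : List ℕ), α ∈ weakCompsL N n →
    α.length = N ∧ α.sum = n
  | 0, n, α, h => by
    unfold weakCompsL at h
    split_ifs at h with hn
    · simp at h; subst h; subst hn; simp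
    · simp at h
  | N + 1, n, α, h => by
    simp only [weakCompsL, List.mem_flatMap, List.mem_range, List.mem_map] at h
    obtain ⟨a, ha, β, hβ, rfl⟩ := h
    obtain ⟨hl, hs⟩ := length_sum_of_mem_weakCompsL N (n - a) β hβ
    simp only [List.length_cons, List.sum_cons, hl, hs, true_and]
    omega

/-- Length of a translate. [folklore] -/
private theorem length_subVecL : ∀ (k : ℕ) {a w : List ℕ}, a.length = w.length → (subVecL k a w).length = w.length
  | k, [], [], _ => rfl
  | k, b :: bs, v :: vs, h => by
    simp only [List.length_cons, Nat.add_right_cancel_iff] at h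
    simp [subVecL, length_subVecL k h]
  | _, [], _ :: _, h => by simp at h
  | _, _ :: _, [], h => by simp at h

/-- Sum of a translate: `|w - k a| + k |a| = |w|` when `k a ≤ w`. [folklore] -/
private theorem sum_subVecL : ∀ (k : ℕ) {a w : List ℕ}, a.length = w.length → leVecL k a w = true →
    (subVecL k a w).sum + k * a.sum = w.sum
  | k, [], [], _, _ => by simp [subVecL]
  | k, b :: bs, v :: vs, hl, h => by
    simp only [leVecL, Bool.and_eq_true, decide_eq_true_eq] at h
    simp only [List.length_cons, Nat.add_right_cancel_iff] at hl
    simp only [subVecL, List.sum_cons, Nat.mul_add]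
    have := sum_subVecL k hl h.2
    omega
  | _, [], _ :: _, h, _ => by simp at h
  | _, _ :: _, [], h, _ => by simp at h

/-- An all-zero vector has sum `0`. [folklore] -/
private theorem sum_eq_zero_of_allZeroL : ∀ (μ : List ℕ), allZeroL μ = true → μ.sum = 0
  | [], _ => rfl
  | a :: as, h => by
    simp only [allZeroL, Bool.and_eq_true, decide_eq_true_eq] at h
    simp [h.1, sum_eq_zero_of_allZeroL as h.2]

/-- **Total-degree pinning** (list form of `sum_eq_of_countVecMultisets_ne_zero`): for a list of
vectors all of sum `n`, a nonzero count at `(d, ν)` forces `|ν| = n·d`. [cite: DorflerIkenmeyerPanova2020, eq. (4.3) (arXiv p. 9)] -/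
theorem countVecMultisetsL_eq_zero_of_sum_ne : ∀ (L : List (List ℕ)) (n : ℕ),
    (∀ α ∈ L, α.sum = n) → ∀ (d : ℕ) (ν : List ℕ), (∀ α ∈ L, α.length = ν.length) →
      ν.sum ≠ n * d → countVecMultisetsL L d ν = 0
  | [], n, _, d, ν, _, hν => by
    rw [countVecMultisetsL]
    split_ifs with h
    · exfalso
      obtain ⟨rfl, hz⟩ := h
      exact hν (by rw [sum_eq_zero_of_allZeroL ν hz, Nat.mul_zero])
    · rfl
  | α :: L, n, hL, d, ν, hlen, hν => by
    rw [countVecMultisetsL]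
    apply sumUpTo_eq_zero
    intro k hk
    split_ifs with h
    · have hα : α.sum = n := hL α (by simp)
      have hαl : α.length = ν.length := hlen α (by simp)
      have hsum := sum_subVecL k hαl h
      apply countVecMultisetsL_eq_zero_of_sum_ne L n (fun β hβ => hL β (List.mem_cons_of_mem _ hβ)) (d - k)
      · intro β hβ
        rw [hlen β (List.mem_cons_of_mem _ hβ), length_subVecL k hαl]
      · rw [hα] at hsum
        intro hc
        apply hν
        have : n * (d - k) + n * k = n * d := by rw [← Nat.mul_add]; congr 1; omega
        rw [← this, ← hc]
        linarith [hsum]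
    · rfl

/-- **Size bound** (list form of `countVecMultisets_le_pow`): `c(L, d, ν) ≤ (|L|+1)^d`.
[folklore] -/
private theorem countVecMultisetsL_le_pow : ∀ (L : List (List ℕ)) (d : ℕ) (ν : List ℕ),
    countVecMultisetsL L d ν ≤ (L.length + 1) ^ d
  | [], d, ν => by
    rw [countVecMultisetsL]
    split_ifs <;> simp
  | α :: L, d, ν => by
    rw [countVecMultisetsL, List.length_cons]
    -- each term is `≤ (|L|+1)^{d-k}`, and `Σ_{k ≤ d} x^{d-k} ≤ (x+1)^d`
    have hterm : ∀ k ≤ d, (if leVecL k α ν = true then countVecMultisetsL L (d - k) (subVecL k α ν)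
        else 0) ≤ (L.length + 1) ^ (d - k) := by
      intro k hk
      split_ifs
      · exact countVecMultisetsL_le_pow L _ _
      · exact Nat.zero_le _
    refine le_trans (sumUpTo_le_sumUpTo hterm) ?_
    -- `Σ_{k≤d} x^{d-k} ≤ (x+1)^d` for `x = |L|+1 ≥ 1`
    have key : ∀ (x d : ℕ), 1 ≤ x → sumUpTo (fun k => x ^ (d - k)) d ≤ (x + 1) ^ d := by
      intro x d hx
      induction d with
      | zero => simp [sumUpTo]
      | succ d ih =>
        rw [sumUpTo_succ_left]
        have hshift : sumUpTo (fun k => x ^ (d + 1 - (k + 1))) d = sumUpTo (fun k => x ^ (d - k)) d :=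
          sumUpTo_congr fun k _ => by rw [Nat.succ_sub_succ]
        rw [hshift, Nat.sub_zero]
        calc x ^ (d + 1) + sumUpTo (fun k => x ^ (d - k)) d
            ≤ x ^ (d + 1) + (x + 1) ^ d := Nat.add_le_add_left ih _
          _ ≤ x * (x + 1) ^ d + (x + 1) ^ d := by
              apply Nat.add_le_add_right
              rw [pow_succ', ]
              exact Nat.mul_le_mul_left _ (Nat.pow_le_pow_left (Nat.le_succ x) d)
          _ = (x + 1) ^ (d + 1) := by ring
    exact key _ _ (Nat.succ_pos _)

end Counting

/-! ### §5 The packed programme and its invariant -/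

section DP

/-- One composition step on the packed layers `1, …, d`, given the new layer below (`prev`):
`new_{e+1} = old_{e+1} + ((new_e &&& mask) · 2^{sh})`. [folklore] -/
def stepTail (mask sh : ℕ) : List ℕ → ℕ → List ℕ
  | [], _ => []
  | x :: xs, prev =>
      let y := x + (prev &&& mask) * 2 ^ sh
      y :: stepTail mask sh xs y

/-- One composition step on all packed layers (`new_0 = old_0`). [folklore] -/
def step (mask sh : ℕ) : List ℕ → List ℕ
  | [] => []
  | x :: xs => x :: stepTail mask sh xs x

/-- The programme over a list of compositions (full vectors `a₀ :: αt`; only the tail `αt` enters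
positions and masks): layers for `α :: L` from layers for `L`.
[cite: DorflerIkenmeyerPanova2020, eq. (4.3) (arXiv p. 9)] -/
def run (F : ℕ) (D : List ℕ) : List (List ℕ) → List ℕ → List ℕ
  | [], T => T
  | α :: L, T => step (maskL F (shrink D α.tail) D) (F * posL D α.tail) (run F D L T)

/-- The layers for the empty list of compositions: only the empty multiset, layer `0`, cell `0`.
[folklore] -/
def initT (d : ℕ) : List ℕ := 1 :: List.replicate d 0

/-- **The packed tables of `N`-letter monomial counts**: layer `e ≤ d` of `tables F D N n d` holds,
at the position `posL D w` of a box cell `w` (`InBox D w`, `|D| = N - 1`), the digit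
`countVecMultisetsL (weakCompsL N n) e ((n e - |w|) :: w)` (`digitAt_tables`).
[cite: DorflerIkenmeyerPanova2020, eq. (4.3) (arXiv p. 9)] -/
def tables (F : ℕ) (D : List ℕ) (N n d : ℕ) : List ℕ :=
  run F D (weakCompsL N n) (initT d)

/-- The count stored at a cell: coordinate `0` is pinned by the total degree. [folklore] -/
def cvmT (L : List (List ℕ)) (n e : ℕ) (w : List ℕ) : ℕ :=
  countVecMultisetsL L e ((n * e - w.sum) :: w)

/-- A packed layer is correct: every digit below the volume is the count of its cell, and there
are no digits beyond. [folklore] -/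
private def LayerOK (F : ℕ) (D : List ℕ) (n : ℕ) (L : List (List ℕ)) (e X : ℕ) : Prop :=
  ∀ p, digitAt F X p = if p < strideL D then cvmT L n e (decodeL D p) else 0

/-- All `d+1` layers are correct. [folklore] -/
private def TablesOK (F : ℕ) (D : List ℕ) (n d : ℕ) (L : List (List ℕ)) (T : List ℕ) : Prop :=
  T.length = d + 1 ∧ ∀ e ≤ d, LayerOK F D n L e (T.getD e 0)

variable {F : ℕ} {D : List ℕ} {n : ℕ}

/-- A correct layer read at a cell. [folklore] -/
private theorem LayerOK.apply_cell {L : List (List ℕ)} {e X : ℕ} (hX : LayerOK F D n L e X) {w : List ℕ}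
    (hw : InBox D w) : digitAt F X (posL D w) = cvmT L n e w := by
  rw [hX, if_pos (posL_lt_strideL hw), decodeL_posL hw]

/-- The digits of a correct layer are bounded by the size bound of the counts. [folklore] -/
private theorem LayerOK.digit_le {L : List (List ℕ)} {e X : ℕ} (hX : LayerOK F D n L e X) (p : ℕ) :
    digitAt F X p ≤ (L.length + 1) ^ e := by
  rw [hX]
  split_ifs
  · exact countVecMultisetsL_le_pow _ _ _
  · exact Nat.zero_le _

/-- Plumbing lemma `length_stepTail` (list/table bookkeeping). [folklore] -/
private theorem length_stepTail (mask sh : ℕ) : ∀ (xs : List ℕ) (prev : ℕ),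
    (stepTail mask sh xs prev).length = xs.length
  | [], _ => rfl
  | x :: xs, prev => by simp [stepTail, length_stepTail mask sh xs]

/-- Plumbing lemma `length_step` (list/table bookkeeping). [folklore] -/
private theorem length_step (mask sh : ℕ) : ∀ (T : List ℕ), (step mask sh T).length = T.length
  | [] => rfl
  | x :: xs => by simp [step, length_stepTail]

/-- Plumbing lemma `stepTail_getD_zero` (list/table bookkeeping). [folklore] -/
private theorem stepTail_getD_zero (mask sh : ℕ) : ∀ (xs : List ℕ) (prev : ℕ), xs ≠ [] →
    (stepTail mask sh xs prev).getD 0 0 = xs.getD 0 0 + (prev &&& mask) * 2 ^ sh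
  | [], _, h => absurd rfl h
  | x :: xs, prev, _ => by simp [stepTail]

/-- Plumbing lemma `stepTail_getD_succ` (list/table bookkeeping). [folklore] -/
private theorem stepTail_getD_succ (mask sh : ℕ) : ∀ (xs : List ℕ) (prev j : ℕ), j + 1 < xs.length →
    (stepTail mask sh xs prev).getD (j + 1) 0 =
      xs.getD (j + 1) 0 + ((stepTail mask sh xs prev).getD j 0 &&& mask) * 2 ^ sh
  | [], _, _, h => by simp at h
  | x :: xs, prev, 0, h => by
    have hne : xs ≠ [] := by rintro rfl; simp at h
    simp only [stepTail, List.getD_cons_succ, List.getD_cons_zero]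
    rw [stepTail_getD_zero mask sh xs _ hne]
  | x :: xs, prev, j + 1, h => by
    simp only [stepTail, List.getD_cons_succ]
    exact stepTail_getD_succ mask sh xs _ j (by simpa using h)

/-- Plumbing lemma `step_getD_zero` (list/table bookkeeping). [folklore] -/
private theorem step_getD_zero (mask sh : ℕ) : ∀ (T : List ℕ), (step mask sh T).getD 0 0 = T.getD 0 0
  | [] => rfl
  | x :: xs => by simp [step]

/-- Plumbing lemma `step_getD_succ` (list/table bookkeeping). [folklore] -/
private theorem step_getD_succ (mask sh : ℕ) : ∀ (T : List ℕ) (e : ℕ), e + 1 < T.length →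
    (step mask sh T).getD (e + 1) 0 = T.getD (e + 1) 0 + ((step mask sh T).getD e 0 &&& mask) * 2 ^ sh
  | [], e, h => by simp at h
  | x :: xs, 0, h => by
    have hne : xs ≠ [] := by rintro rfl; simp at h
    simp only [step, List.getD_cons_succ, List.getD_cons_zero]
    exact stepTail_getD_zero mask sh xs x hne
  | x :: xs, e + 1, h => by
    simp only [step, List.getD_cons_succ]
    exact stepTail_getD_succ mask sh xs x e (by simpa using h)

/-- The initial layers represent the counts for the empty composition list.
[cite: DorflerIkenmeyerPanova2020, eq. (4.3) (arXiv p. 9)] -/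
private theorem tablesOK_initT (hF : 0 < F) (hD : 0 < strideL D) (d : ℕ) : TablesOK F D n d [] (initT d) := by
  refine ⟨by simp [initT], fun e he p => ?_⟩
  unfold cvmT
  rw [countVecMultisetsL]
  rcases e with _ | e
  · have hget : (initT d).getD 0 0 = 1 := by simp [initT]
    rw [hget, digitAt_of_lt (Nat.one_lt_two_pow hF.ne')]
    by_cases hp : p < strideL D
    · rw [if_pos hp]
      have hdec := posL_decodeL D p hp
      -- `decodeL D p` is the zero vector iff `p = 0`
      have hall : allZeroL (decodeL D p) = true ↔ p = 0 := by
        constructor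
        · intro h
          have hz : ∀ (E μ : List ℕ), allZeroL μ = true → posL E μ = 0 := by
            intro E μ
            induction μ generalizing E with
            | nil => intro; cases E <;> simp [posL]
            | cons a as ih =>
              intro h
              simp only [allZeroL, Bool.and_eq_true, decide_eq_true_eq] at h
              cases E with
              | nil => simp [posL]
              | cons d ds => simp [posL, h.1, ih ds h.2]
          rw [← hdec, hz D _ h]
        · rintro rfl
          have : ∀ E : List ℕ, allZeroL (decodeL E 0) = true := by
            intro E
            induction E with
            | nil => simp [decodeL, allZeroL]
            | cons d ds ih => simp [decodeL, allZeroL, ih]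
          exact this D
      by_cases h0 : p = 0
      · rw [if_pos h0, if_pos]
        exact ⟨rfl, by simpa [allZeroL] using hall.mpr h0⟩
      · rw [if_neg h0, if_neg]
        rintro ⟨-, h⟩
        exact h0 (hall.mp (by simpa [allZeroL] using h))
    · rw [if_neg hp, if_neg]
      omega
  · have hget : (initT d).getD (e + 1) 0 = 0 := by
      unfold initT
      rw [List.getD_cons_succ, List.getD_eq_getElem?_getD, List.getElem?_replicate]
      split_ifs <;> rfl
    rw [hget, digitAt_zero]
    split_ifs with h1 h2
    · simp at h2
    · rfl
    · rfl

/-- **The masked, shifted digit is the second summand of the geometric step**: for the new layer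
`e` (`X`, correct for `α :: L`) and a box cell `w`, the digit of `(X &&& mask_α) · 2^{F·posL αt}` at
`posL D w` is `[αt ≤ w] · cvmT (α::L) e (w - αt)`; at positions beyond the volume it is `0`.
[cite: DorflerIkenmeyerPanova2020, eq. (4.3) (arXiv p. 9)] -/
private theorem digitAt_shift (hF : 0 < F) {α : List ℕ} {L : List (List ℕ)} (hα : α.tail.length = D.length)
    {e X : ℕ} (hX : LayerOK F D n (α :: L) e X) (p : ℕ) :
    digitAt F ((X &&& maskL F (shrink D α.tail) D) * 2 ^ (F * posL D α.tail)) p =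
      if p < strideL D then
        (if leVecL 1 α.tail (decodeL D p) = true then cvmT (α :: L) n e (subVecL 1 α.tail (decodeL D p))
          else 0)
      else 0 := by
  classical
  rw [digitAt_mul_pow]
  have hle : LeVec (shrink D α.tail) D := leVec_shrink D α.tail hα
  -- the digits of the masked layer: supported on the cells `w'` with `w' + αt` in the box
  have hmasked : ∀ q, digitAt F (X &&& maskL F (shrink D α.tail) D) q =
      if q < strideL D ∧ InBox (shrink D α.tail) (decodeL D q) then cvmT (α :: L) n e (decodeL D q)
      else 0 := by
    intro q
    rw [digitAt_land]
    by_cases hq : q < strideL D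
    · obtain ⟨w, hbox, rfl⟩ : ∃ w, InBox D w ∧ posL D w = q :=
        ⟨_, inBox_decodeL D q hq, posL_decodeL D q hq⟩
      rw [decodeL_posL hbox, digitAt_maskL_posL hF hle hbox, hX.apply_cell hbox]
      by_cases hin : InBox (shrink D α.tail) w
      · rw [if_pos hin, if_pos (show _ ∧ _ from ⟨hq, hin⟩), land_ones_of_lt]
        rw [← hX.apply_cell hbox]; exact digitAt_lt _ _ _
      · rw [if_neg hin, if_neg (show ¬(_ < strideL D ∧ InBox (shrink D α.tail) w) from fun h => hin h.2),
          Nat.and_zero]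
    · rw [digitAt_eq_zero_of_lt (maskL_lt hF hle) (not_lt.mp hq), Nat.and_zero,
        if_neg (show ¬(q < strideL D ∧ _) from fun h => hq h.1)]
  -- from a masked source cell `w'` one reads the translate `w' + αt`, a box cell at `posL w' + posL αt`
  have source : ∀ {q : ℕ}, q < strideL D → InBox (shrink D α.tail) (decodeL D q) →
      InBox D (addVecL (decodeL D q) α.tail) ∧
        posL D (addVecL (decodeL D q) α.tail) = q + posL D α.tail := by
    intro q hq hin
    exact ⟨inBox_addVecL_of_inBox_shrink hα hin, by
      rw [posL_addVecL D _ α.tail (length_eq_of_inBox_shrink hα hin) hα, posL_decodeL D q hq]⟩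
  by_cases hs : posL D α.tail ≤ p
  · rw [if_pos hs, hmasked]
    by_cases hp : p < strideL D
    · rw [if_pos hp]
      obtain ⟨w, hbox, rfl⟩ : ∃ w, InBox D w ∧ posL D w = p :=
        ⟨_, inBox_decodeL D p hp, posL_decodeL D p hp⟩
      rw [decodeL_posL hbox]
      have hαw : α.tail.length = w.length := by rw [hbox.length_eq, hα]
      by_cases hl : leVecL 1 α.tail w = true
      · rw [if_pos hl]
        have hsub : InBox (shrink D α.tail) (subVecL 1 α.tail w) := inBox_shrink_subVecL hα hbox hl
        have hsub' : InBox D (subVecL 1 α.tail w) := inBox_of_leVec hle hsub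
        have hpos : posL D w = posL D (subVecL 1 α.tail w) + posL D α.tail := by
          conv_lhs => rw [← addVecL_subVecL_of_leVecL hαw hl]
          exact posL_addVecL D _ _ (length_eq_of_inBox_shrink hα hsub) hα
        rw [hpos, Nat.add_sub_cancel, decodeL_posL hsub',
          if_pos (show _ ∧ _ from ⟨posL_lt_strideL hsub', hsub⟩)]
      · rw [if_neg hl, if_neg]
        rintro ⟨hq, hin⟩
        apply hl
        obtain ⟨hbox', hsum⟩ := source hq hin
        have heq : addVecL (decodeL D (posL D w - posL D α.tail)) α.tail = w := by
          rw [← decodeL_posL hbox', hsum, Nat.sub_add_cancel hs, decodeL_posL hbox]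
        rw [← heq]
        exact (leVecL_subVecL_of_addVecL_eq
          (by rw [hα]; exact (length_eq_of_inBox_shrink hα hin).symm)).1
    · rw [if_neg hp, if_neg]
      rintro ⟨hq, hin⟩
      apply hp
      obtain ⟨hbox', hsum⟩ := source hq hin
      rw [Nat.sub_add_cancel hs] at hsum
      rw [← hsum]
      exact posL_lt_strideL hbox'
  · rw [if_neg hs]
    by_cases hp : p < strideL D
    · rw [if_pos hp]
      by_cases hl : leVecL 1 α.tail (decodeL D p) = true
      · exfalso
        apply hs
        obtain ⟨w, hbox, rfl⟩ : ∃ w, InBox D w ∧ posL D w = p :=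
          ⟨_, inBox_decodeL D p hp, posL_decodeL D p hp⟩
        rw [decodeL_posL hbox] at hl
        have hαw : α.tail.length = w.length := by rw [hbox.length_eq, hα]
        have hsub : InBox (shrink D α.tail) (subVecL 1 α.tail w) := inBox_shrink_subVecL hα hbox hl
        have hpos : posL D w = posL D (subVecL 1 α.tail w) + posL D α.tail := by
          conv_lhs => rw [← addVecL_subVecL_of_leVecL hαw hl]
          exact posL_addVecL D _ _ (length_eq_of_inBox_shrink hα hsub) hα
        rw [hpos]
        exact Nat.le_add_left _ _
      · rw [if_neg hl]
    · rw [if_neg hp]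

/-- **One step of the programme is correct**: the tables for `L` yield the tables for `α :: L`.
[cite: DorflerIkenmeyerPanova2020, eq. (4.3) (arXiv p. 9)] -/
private theorem tablesOK_step (hF : 0 < F) {d : ℕ} {α : List ℕ} {L : List (List ℕ)}
    (hL : ∀ β ∈ α :: L, β.length = D.length + 1 ∧ β.sum = n) (hαne : α ≠ [])
    (hbound : (L.length + 2) ^ d < 2 ^ F) {T : List ℕ}
    (hT : TablesOK F D n d L T) :
    TablesOK F D n d (α :: L) (step (maskL F (shrink D α.tail) D) (F * posL D α.tail) T) := by
  obtain ⟨hlen, hT⟩ := hT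
  have hαn : α.sum = n := (hL α (by simp)).2
  have hα : α.tail.length = D.length := by
    have := (hL α (by simp)).1
    rw [List.length_tail, this]; rfl
  refine ⟨by rw [length_step, hlen], ?_⟩
  intro e
  induction e with
  | zero =>
    intro _ p
    rw [step_getD_zero, hT 0 (Nat.zero_le _) p]
    unfold cvmT
    rw [countVecMultisetsL_cons_zero]
  | succ e ih =>
    intro he p
    have he' : e ≤ d := Nat.le_of_succ_le he
    have hnew : LayerOK F D n (α :: L) e ((step (maskL F (shrink D α.tail) D) (F * posL D α.tail) T).getD e 0) :=
      ih he'
    rw [step_getD_succ _ _ T e (by rw [hlen]; omega)]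
    -- carry-free addition of the old layer `e+1` and the masked shifted new layer `e`
    have hA : ∀ q, digitAt F (T.getD (e + 1) 0) q =
        if q < strideL D then cvmT L n (e + 1) (decodeL D q) else 0 := hT (e + 1) he
    have hC := digitAt_shift hF hα hnew
    have nocarry : ∀ q, digitAt F (T.getD (e + 1) 0) q +
        digitAt F ((((step (maskL F (shrink D α.tail) D) (F * posL D α.tail) T).getD e 0) &&&
          maskL F (shrink D α.tail) D) * 2 ^ (F * posL D α.tail)) q < 2 ^ F := by
      intro q
      rw [hA, hC]
      have h1 : cvmT L n (e + 1) (decodeL D q) ≤ (L.length + 1) ^ (e + 1) := countVecMultisetsL_le_pow _ _ _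
      have h2 : ∀ v, cvmT (α :: L) n e v ≤ (L.length + 2) ^ e := fun v => by
        have := countVecMultisetsL_le_pow (α :: L) e ((n * e - v.sum) :: v)
        simpa [cvmT, List.length_cons] using this
      have h3 : (L.length + 1) ^ (e + 1) + (L.length + 2) ^ e ≤ (L.length + 2) ^ (e + 1) := by
        rw [pow_succ, pow_succ]
        have : (L.length + 1) ^ e ≤ (L.length + 2) ^ e := Nat.pow_le_pow_left (by omega) e
        nlinarith
      have h4 : (L.length + 2) ^ (e + 1) ≤ (L.length + 2) ^ d := Nat.pow_le_pow_right (by omega) he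
      have h2' := h2 (subVecL 1 α.tail (decodeL D q))
      split_ifs <;> omega
    rw [digitAt_add _ _ nocarry, hA, hC]
    by_cases hq : p < strideL D
    · rw [if_pos hq, if_pos hq, if_pos hq]
      unfold cvmT
      rw [countVecMultisetsL_cons_succ]
      congr 1
      -- the guard `α ≤ (n(e+1) - |w|) :: w` versus `αt ≤ w`, and the translated cell
      obtain ⟨a0, αt, rfl⟩ : ∃ a0 αt, α = a0 :: αt := by
        cases α with
        | nil => exact absurd rfl hαne
        | cons a0 αt => exact ⟨a0, αt, rfl⟩
      simp only [List.tail_cons] at hα hC hnew ⊢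
      simp only [List.sum_cons] at hαn
      set w := decodeL D p with hw
      have hbox : InBox D w := inBox_decodeL D p hq
      have hαw : αt.length = w.length := by rw [hbox.length_eq, hα]
      simp only [leVecL, Nat.one_mul, Bool.and_eq_true, decide_eq_true_eq, subVecL]
      by_cases hl : leVecL 1 αt w = true
      · have hs := sum_subVecL_of_leVecL hαw hl
        by_cases h0 : a0 ≤ n * (e + 1) - w.sum
        · rw [if_pos (show a0 ≤ n * (e + 1) - w.sum ∧ leVecL 1 αt w = true from ⟨h0, hl⟩), if_pos hl]
          congr 2
          rw [Nat.mul_succ]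
          omega
        · rw [if_neg (show ¬(a0 ≤ n * (e + 1) - w.sum ∧ leVecL 1 αt w = true) from fun h => h0 h.1),
            if_pos hl]
          -- the count vanishes by total-degree pinning: `|w - αt| > n e`
          have hlt : n * e < (subVecL 1 αt w).sum := by
            rw [Nat.mul_succ] at h0
            omega
          apply countVecMultisetsL_eq_zero_of_sum_ne ((a0 :: αt) :: L) n
          · exact fun β hβ => (hL β hβ).2
          · intro β hβ
            rw [(hL β hβ).1, List.length_cons]
            have : (subVecL 1 αt w).length + αt.sum = (subVecL 1 αt w).length + αt.sum := rfl
            -- lengths: `|w - αt| = |w| = |D|`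
            have hl2 : (subVecL 1 αt w).length = w.length := by
              have h1 := length_eq_of_inBox_shrink hα (inBox_shrink_subVecL hα hbox hl)
              rw [h1, hbox.length_eq]
            rw [hl2, hbox.length_eq]
          · rw [List.sum_cons]
            omega
      · rw [if_neg (show ¬(a0 ≤ n * (e + 1) - w.sum ∧ leVecL 1 αt w = true) from fun h => hl h.2),
          if_neg hl]
    · rw [if_neg hq, if_neg hq, if_neg hq]

/-- **The whole programme is correct** for a list of compositions of `n` of length `|D| + 1`.
[cite: DorflerIkenmeyerPanova2020, eq. (4.3) (arXiv p. 9)] -/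
private theorem tablesOK_run (hF : 0 < F) (hD : 0 < strideL D) {d : ℕ} :
    ∀ (L : List (List ℕ)), (∀ β ∈ L, β.length = D.length + 1 ∧ β.sum = n) →
      (L.length + 1) ^ d < 2 ^ F → TablesOK F D n d L (run F D L (initT d))
  | [], _, _ => tablesOK_initT hF hD d
  | α :: L, hL, hb => by
    rw [run]
    have hαne : α ≠ [] := by
      intro h
      have := (hL α (by simp)).1
      rw [h] at this
      simp at this
    refine tablesOK_step hF hL hαne (by simpa using hb) ?_
    exact tablesOK_run hF hD L (fun β hβ => hL β (List.mem_cons_of_mem _ hβ))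
      (lt_of_le_of_lt (Nat.pow_le_pow_left (by simp) d) hb)

/-- **Digits of the packed tables are the monomial counts** (Dörfler–Ikenmeyer–Panova (4.3) in
`N = |D| + 1` letters): for a box cell `w` and a layer `e ≤ d`,
`digitAt F (tables F D N n d)[e] (posL D w) = countVecMultisetsL (weakCompsL N n) e ((n e - |w|) :: w)`,
provided the digits cannot overflow (`(|weakCompsL N n| + 1)^d < 2^F`).
[cite: DorflerIkenmeyerPanova2020, eq. (4.3) (arXiv p. 9)] -/
theorem digitAt_tables {N d e : ℕ} (hF : 0 < F) (hD : 0 < strideL D) (hN : D.length + 1 = N)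
    (hb : ((weakCompsL N n).length + 1) ^ d < 2 ^ F) (he : e ≤ d) {w : List ℕ} (hw : InBox D w) :
    digitAt F ((tables F D N n d).getD e 0) (posL D w) =
      countVecMultisetsL (weakCompsL N n) e ((n * e - w.sum) :: w) := by
  have hL : ∀ β ∈ weakCompsL N n, β.length = D.length + 1 ∧ β.sum = n := by
    intro β hβ
    have := length_sum_of_mem_weakCompsL N n β hβ
    rw [hN]
    exact this
  have hT := tablesOK_run (n := n) hF hD (weakCompsL N n) hL hb
  exact (hT.2 e he).apply_cell hw

/-- The same with the pinned coordinate spelled out: for `|ν| = n e` (the only case with a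
nonzero count, `countVecMultisetsL_eq_zero_of_sum_ne`), `ν = ν₀ :: w` with `w` a box cell,
`c_ν(e, n) = digitAt F (tables F D N n d)[e] (posL D w)`. [cite: DorflerIkenmeyerPanova2020, eq. (4.3) (arXiv p. 9)] -/
theorem countVecMultisetsL_eq_digitAt_tables {N d e : ℕ} (hF : 0 < F) (hD : 0 < strideL D)
    (hN : D.length + 1 = N) (hb : ((weakCompsL N n).length + 1) ^ d < 2 ^ F) (he : e ≤ d)
    {ν₀ : ℕ} {w : List ℕ} (hw : InBox D w) (hsum : ν₀ + w.sum = n * e) :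
    countVecMultisetsL (weakCompsL N n) e (ν₀ :: w) =
      digitAt F ((tables F D N n d).getD e 0) (posL D w) := by
  rw [digitAt_tables hF hD hN hb he hw]
  congr 2
  omega

end DP

end BoxDP

end Literature.Computability.AlgebraicComplexity
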